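import Literature.AlgebraicGeometry.Frobenioids.BirationalizationFrobeniusGeneral
import Literature.AlgebraicGeometry.Frobenioids.PreFrobenioidDataToFunctor
import HarnessLib

/-!
# Frobenioids I, Proposition 4.4 (ii) in the author's corrected 2024 form, GENERAL CASE:
# `C^birat` IS A FROBENIOID for every Frobenioid of birationally Frobenius-normalized type

Mochizuki, *The geometry of Frobenioids I: the general theory*, Kyushu J. Math. **62** (2008)
293–400, §4, Proposition 4.4 (ii), kurims text p. 83 [cite: MochizukiFrdI2008, Prop. 4.4 (ii) p.83], as
corrected in the author's *Comments* (2024) (29)(i): "Suppose, further, that `C` is of birationally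
Frobenius-normalized type [cf. Definition 4.5, (i), below]. Then the pre-Frobenioid `C^birat` is a
Frobenioid"; and (29)(ii): "it is now a routine exercise to check, whenever `C` is of birationally
Frobenius-normalized type …, that `C^birat` is, in fact, a Frobenioid of group-like type."

PROOF-ONLY file (seat abc-iut-L6-t20; abc-iut cell row W14, STAGE 2). `BirationalizationIsFrobenioid.lean`
(seat abc-iut-w5-d227, over this seat's `BirationalizationPullbackFactorization.lean`) proves the statement
for `C` of ISOTROPIC type — the case the cell's cone consumes (`C^istr`). Here the isotropy hypothesis is
REMOVED: for an arbitrary Frobenioid `C` all of whose objects are birationally Frobenius-normalized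
(Def. 4.5 (i)), `Birat.toElemZero hF hsq : C^birat ⥤ F_{0_D}` satisfies Def. 1.3 (i)–(vii)
[cite: MochizukiFrdI2008, Def. 1.3 p.24]. The isotropy-free ingredients
(`BirationalizationCoAngularGeneral.lean`, `BirationalizationFrobeniusGeneral.lean`): co-angular pre-steps
of `C^birat` are exactly the isomorphisms; `[(α, φ′)]` is co-angular iff `φ′` is; every endomorphism of
`X^birat` is co-angular; `C → C^birat` preserves monomorphisms. This file: (iii)(a) via a composition
square (Prop. 1.11 (vii)) whose right leg is co-angular; (iii)(b) since a co-angular pre-step is an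
isomorphism and every morphism parallel to an isomorphism is co-angular; (iii)(c) conjugation, its
dependence on `Base(φ)` alone being the commutativity of `O^▷(X^birat)` = the degree-one case of the
birational Frobenius-normalization (the ONLY use of that hypothesis); (iii)(d), (v)(b)(c), (vi) because
co-angular pre-steps are isomorphisms; (vii)(a): the image of an isotropic hull `h : A → A^istr` is an
isotropic hull of `A^birat` (a morphism `[(δ, γ′)] : A^birat ⇢ Z` with `Z` isotropic factors through the
hull of the apex `E` of the fraction; the induced `E^istr → A^istr` is a co-angular pre-step — every
arrow out of an isotropic object is co-angular — hence invertible in `C^birat`); (vii)(b) via "co-angular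
pre-steps into isotropic objects have isotropic domain". Main result:
`PreFrobenioid.Birat.isFrobenioid_general`. No statement of the paper is strengthened; nothing here
concerns the disputed parts of IUT.
-/

namespace Literature.AlgebraicGeometry.Frobenioids

open CategoryTheory Opposite

universe w v v' u u'

namespace PreFrobenioid

variable {D : Type u} [Category.{v} D] {Φ : Dᵒᵖ ⥤ CommMonCat.{w}}
  {C : Type u'} [Category.{v'} C] {F : C ⥤ ElemFrobenioid Φ}
  {hF : IsFrobenioid F} {hsq : HasBiratSquares F}

namespace Birat

/-! ### Def. 1.3 (iii) -/

/-- **Def. 1.3 (iii)(a) for `C^birat`**, every Frobenioid `C`: the composite of co-angular `[(α₁, φ₁′)]`,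
`[(α₂, φ₂′)]` is `[(κ ≫ α₁, φ″ ≫ φ₂′)]` for a square `κ ≫ φ₁′ = φ″ ≫ α₂` (Prop. 1.11 (vii)); `φ″` is
co-angular in `C` (its image is `κ^birat ≫ φ₁′^birat ≫ (α₂^birat)⁻¹`), hence so is `φ″ ≫ φ₂′`
(Def. 1.3 (iii)(a) of `C`). [cite: MochizukiFrdI2008, Prop. 4.4 (ii) p.83] -/
theorem iii_a' ⦃X Y Z : Birat F hF hsq⦄ (f : X ⟶ Y) (g : Y ⟶ Z)
    (hf : IsCoAngular (toElemZero hF hsq) f) (hg : IsCoAngular (toElemZero hF hsq) g) :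
    IsCoAngular (toElemZero hF hsq) (f ≫ g) := by
  obtain ⟨f₁, rfl⟩ := homMk_surjective f
  obtain ⟨g₁, rfl⟩ := homMk_surjective g
  have hf₁ : IsCoAngular F f₁.num := (isCoAngular_homMk_iff' f₁).mp hf
  have hg₁ : IsCoAngular F g₁.num := (isCoAngular_homMk_iff' g₁).mp hg
  obtain ⟨S⟩ := BiratFrac.nonempty_square hsq f₁ g₁
  rw [homMk_comp_homMk_eq f₁ g₁ S]
  refine (isCoAngular_homMk_iff' (BiratFrac.compWith hF f₁ g₁ S)).mpr ?_
  -- the right leg of the square is co-angular in `C`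
  have hr : IsCoAngular F S.right := by
    haveI := toBirat_inverts hF hsq g₁.den g₁.den_mem
    haveI := toBirat_inverts hF hsq S.left S.left_mem
    apply isCoAngular_of_toElemZero_map (hF := hF) (hsq := hsq)
    have e : (toBirat F hF hsq).map S.right =
        ((toBirat F hF hsq).map S.left ≫ (toBirat F hF hsq).map f₁.num) ≫
          inv ((toBirat F hF hsq).map g₁.den) := by
      rw [← Functor.map_comp, S.w, Functor.map_comp, Category.assoc, IsIso.hom_inv_id, Category.comp_id]
    rw [e]
    exact ((isCoAngular_toElemZero_map hf₁).iso_comp ((toBirat F hF hsq).map S.left)).comp_iso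
      (inv ((toBirat F hF hsq).map g₁.den))
  exact hF.iii_a S.right g₁.num hr hg₁

/-- **Def. 1.3 (iii)(b) for `C^birat`**, every Frobenioid `C`: a co-angular pre-step `φ : X ⇢ Y` is an
isomorphism, and every morphism parallel to an isomorphism is co-angular.
[cite: MochizukiFrdI2008, Prop. 4.4 (ii) p.83] -/
theorem iii_b' ⦃X Y : Birat F hF hsq⦄ (φ : X ⟶ Y) (hφ : IsCoAngularPreStep (toElemZero hF hsq) φ)
    (ψ : X ⟶ Y) : IsCoAngular (toElemZero hF hsq) ψ := by
  haveI := isIso_of_isCoAngularPreStep' φ hφ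
  exact isCoAngular_of_parallel_iso φ ψ

/-- **Def. 1.3 (iii)(c) for `C^birat`, existence**, every Frobenioid `C`: conjugation by the (invertible)
co-angular pre-step. [cite: MochizukiFrdI2008, Prop. 4.4 (ii) p.83] -/
theorem iii_c' ⦃X Y : Birat F hF hsq⦄ (φ : X ⟶ Y) (hφ : IsCoAngularPreStep (toElemZero hF hsq) φ) :
    ∃ e : endSubmonoid (toElemZero hF hsq) X ≃* endSubmonoid (toElemZero hF hsq) Y,
      ∀ α : endSubmonoid (toElemZero hF hsq) X,
        φ ≫ (show Y ⟶ Y from (e α).1) = (show X ⟶ X from α.1) ≫ φ := by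
  haveI : IsIso φ := isIso_of_isCoAngularPreStep' φ hφ
  exact ⟨endSubmonoidConj (toElemZero hF hsq) (asIso φ), hom_comp_endSubmonoidConj (asIso φ)⟩

/-- **`O^▷(X^birat)` is commutative** when every object of `C` is birationally Frobenius-normalized —
the degree-one case of Def. 4.5 (i) (`φ ≫ α^{deg φ} = α ≫ φ` for base-identity `φ` and `α ∈ O^▷`),
the point of the author's 2024 correction (29)(ii). [cite: MochizukiFrdI2008, Def. 4.5 (i) p.86] -/
theorem endSubmonoid_comm_general (hbfn : ∀ A : C, IsBiratFrobeniusNormalized F hF hsq A)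
    (X : Birat F hF hsq) (a b : endSubmonoid (toElemZero hF hsq) X) :
    (show X ⟶ X from a.1) ≫ (show X ⟶ X from b.1) = (show X ⟶ X from b.1) ≫ (show X ⟶ X from a.1) := by
  have hbmem : (b.1 : End ((toBirat F hF hsq).obj X.out)) ∈
      endSubmonoid (toElemGp hF hsq) ((toBirat F hF hsq).obj X.out) := b.2
  have h := hbfn X.out (show (toBirat F hF hsq).obj X.out ⟶ (toBirat F hF hsq).obj X.out from a.1)
    a.2.1 b.1 hbmem
  have hdeg : (degFr (toElemGp hF hsq)
      (show (toBirat F hF hsq).obj X.out ⟶ (toBirat F hF hsq).obj X.out from a.1) : ℕ) = 1 := by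
    rw [show degFr (toElemGp hF hsq)
      (show (toBirat F hF hsq).obj X.out ⟶ (toBirat F hF hsq).obj X.out from a.1) = 1 from a.2.2]
    rfl
  rw [hdeg, pow_one] at h
  exact h

/-- **Def. 1.3 (iii)(c) for `C^birat`, dependence on `Base(φ)` only**, every Frobenioid of birationally
Frobenius-normalized type: the base-identity automorphism `φ⁻¹ φ′` lies in the commutative `O^▷(Y^birat)`.
[cite: MochizukiFrdI2008, Prop. 4.4 (ii) p.83] -/
theorem iii_c_base' (hbfn : ∀ A : C, IsBiratFrobeniusNormalized F hF hsq A)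
    ⦃X Y : Birat F hF hsq⦄ (φ φ' : X ⟶ Y) (hφ : IsCoAngularPreStep (toElemZero hF hsq) φ)
    (hφ' : IsCoAngularPreStep (toElemZero hF hsq) φ')
    (hb : Base (toElemZero hF hsq) φ = Base (toElemZero hF hsq) φ')
    (α : endSubmonoid (toElemZero hF hsq) X) (β β' : endSubmonoid (toElemZero hF hsq) Y)
    (e₁ : φ ≫ (show Y ⟶ Y from β.1) = (show X ⟶ X from α.1) ≫ φ)
    (e₂ : φ' ≫ (show Y ⟶ Y from β'.1) = (show X ⟶ X from α.1) ≫ φ') : β = β' := by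
  haveI : IsIso φ := isIso_of_isCoAngularPreStep' φ hφ
  haveI : IsIso φ' := isIso_of_isCoAngularPreStep' φ' hφ'
  have hwb : Base (toElemZero hF hsq) (inv φ ≫ φ') = 𝟙 _ := by
    rw [base_comp, ← hb, ← base_comp, IsIso.inv_hom_id, base_id]
  have hwl : degFr (toElemZero hF hsq) (inv φ ≫ φ') = 1 := by
    rw [degFr_comp, show degFr (toElemZero hF hsq) φ' = 1 from hφ'.2.1, mul_one]
    exact isLinear_of_isIso (toElemZero hF hsq) (inv φ)
  have hcomm : (inv φ ≫ φ') ≫ (show Y ⟶ Y from β.1) = (show Y ⟶ Y from β.1) ≫ (inv φ ≫ φ') :=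
    endSubmonoid_comm_general hbfn Y ⟨inv φ ≫ φ', ⟨hwb, hwl⟩⟩ β
  have hα : (show X ⟶ X from α.1) = φ ≫ (show Y ⟶ Y from β.1) ≫ inv φ := by
    rw [← Category.assoc, e₁, Category.assoc, IsIso.hom_inv_id, Category.comp_id]
  have hβ' : (show Y ⟶ Y from β'.1) = inv φ' ≫ (show X ⟶ X from α.1) ≫ φ' := by
    rw [← e₂, IsIso.inv_hom_id_assoc]
  apply Subtype.ext
  change (show Y ⟶ Y from β.1) = (show Y ⟶ Y from β'.1)
  rw [hβ', hα]
  simp only [Category.assoc]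
  rw [← hcomm]
  simp only [Category.assoc, IsIso.hom_inv_id_assoc, IsIso.inv_hom_id_assoc]

/-- **Def. 1.3 (iii)(d), coslice, full** (`f := φ⁻¹ ≫ φ′`, all co-angular pre-steps being isomorphisms).
[cite: MochizukiFrdI2008, Prop. 4.4 (ii) p.83] -/
theorem iii_d_under_full' ⦃X Y Y' : Birat F hF hsq⦄ (φ : X ⟶ Y) (φ' : X ⟶ Y')
    (hφ : IsCoAngularPreStep (toElemZero hF hsq) φ) (hφ' : IsCoAngularPreStep (toElemZero hF hsq) φ')
    (_h : Div (toElemZero hF hsq) φ ∣ Div (toElemZero hF hsq) φ') :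
    ∃ f : Y ⟶ Y', IsCoAngularPreStep (toElemZero hF hsq) f ∧ φ ≫ f = φ' := by
  haveI : IsIso φ := isIso_of_isCoAngularPreStep' φ hφ
  haveI : IsIso φ' := isIso_of_isCoAngularPreStep' φ' hφ'
  exact ⟨inv φ ≫ φ', (isCoAngularPreStep_iff_isIso' hF hsq _).mpr inferInstance,
    by rw [IsIso.hom_inv_id_assoc]⟩

/-- **Def. 1.3 (iii)(d), coslice, essentially surjective** (`Φ = 0_D`).
[cite: MochizukiFrdI2008, Prop. 4.4 (ii) p.83] -/
theorem iii_d_under_surj' (X : Birat F hF hsq)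
    (x : (zeroMonoid.{w} D).obj (op (baseObj (toElemZero hF hsq) X))) :
    ∃ (Y : Birat F hF hsq) (φ : X ⟶ Y), IsCoAngularPreStep (toElemZero hF hsq) φ ∧
      Div (toElemZero hF hsq) φ = x :=
  ⟨X, 𝟙 X, (isCoAngularPreStep_iff_isIso' hF hsq _).mpr inferInstance, Subsingleton.elim _ _⟩

/-- **Def. 1.3 (iii)(d), slice, full** (`g := ψ ≫ ψ′⁻¹`). [cite: MochizukiFrdI2008, Prop. 4.4 (ii) p.83] -/
theorem iii_d_over_full' ⦃X Y Y' : Birat F hF hsq⦄ (ψ : Y ⟶ X) (ψ' : Y' ⟶ X)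
    (h : IsCoAngularPreStep (toElemZero hF hsq) ψ) (h' : IsCoAngularPreStep (toElemZero hF hsq) ψ')
    (_hd : invDiv (toElemZero hF hsq) ψ' h'.2.2 ∣ invDiv (toElemZero hF hsq) ψ h.2.2) :
    ∃ g : Y ⟶ Y', IsCoAngularPreStep (toElemZero hF hsq) g ∧ g ≫ ψ' = ψ := by
  haveI : IsIso ψ := isIso_of_isCoAngularPreStep' ψ h
  haveI : IsIso ψ' := isIso_of_isCoAngularPreStep' ψ' h'
  exact ⟨ψ ≫ inv ψ', (isCoAngularPreStep_iff_isIso' hF hsq _).mpr inferInstance,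
    by rw [Category.assoc, IsIso.inv_hom_id, Category.comp_id]⟩

/-- **Def. 1.3 (iii)(d), slice, essentially surjective** (`Φ = 0_D`).
[cite: MochizukiFrdI2008, Prop. 4.4 (ii) p.83] -/
theorem iii_d_over_surj' (X : Birat F hF hsq)
    (x : (zeroMonoid.{w} D).obj (op (baseObj (toElemZero hF hsq) X))) :
    ∃ (Y : Birat F hF hsq) (ψ : Y ⟶ X) (h : IsCoAngularPreStep (toElemZero hF hsq) ψ),
      invDiv (toElemZero hF hsq) ψ h.2.2 = x :=
  ⟨X, 𝟙 X, (isCoAngularPreStep_iff_isIso' hF hsq _).mpr inferInstance, Subsingleton.elim _ _⟩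

/-! ### Def. 1.3 (v)(b)(c), (vi) -/

/-- **Def. 1.3 (v)(b) for `C^birat`, existence**, every Frobenioid `C`: a pre-step `[(α, ψ′)]` with
`ψ′ = ι ∘ b` (Def. 1.3 (v)(b) in `C`: `b` a co-angular pre-step, `ι` an isometric pre-step) is
`((α^birat)⁻¹ ≫ b^birat) ≫ ι^birat`: an isomorphism (a co-angular pre-step of `C^birat`) followed by an
isometric pre-step. [cite: MochizukiFrdI2008, Prop. 4.4 (ii) p.83] -/
theorem v_b_exists' ⦃X Y : Birat F hF hsq⦄ (ψ : X ⟶ Y) (hψ : IsPreStep (toElemZero hF hsq) ψ) :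
    ∃ (Z : Birat F hF hsq) (β : X ⟶ Z) (α : Z ⟶ Y), β ≫ α = ψ ∧
      IsCoAngularPreStep (toElemZero hF hsq) β ∧
      (IsIsometry (toElemZero hF hsq) α ∧ IsPreStep (toElemZero hF hsq) α) := by
  obtain ⟨f, rfl⟩ := homMk_surjective ψ
  obtain ⟨R, b, ι, hbι, hb, hι⟩ := hF.v_b_exists f.num (isPreStep_num f hψ)
  haveI := toBirat_inverts hF hsq f.den f.den_mem
  haveI := toBirat_inverts hF hsq b hb
  have key : (inv ((toBirat F hF hsq).map f.den) ≫ (toBirat F hF hsq).map b) ≫ (toBirat F hF hsq).map ι =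
      (homMk f : (toBirat F hF hsq).obj X.out ⟶ (toBirat F hF hsq).obj Y.out) := by
    rw [homMk_eq_inv_comp f, ← hbι, Functor.map_comp, Category.assoc]
  have hβ : IsCoAngularPreStep (toElemZero hF hsq)
      (inv ((toBirat F hF hsq).map f.den) ≫ (toBirat F hF hsq).map b :
        (toBirat F hF hsq).obj X.out ⟶ (toBirat F hF hsq).obj R) :=
    (isCoAngularPreStep_iff_isIso' hF hsq _).mpr inferInstance
  exact ⟨(toBirat F hF hsq).obj R, _,
    ((toBirat F hF hsq).map ι : (toBirat F hF hsq).obj R ⟶ (toBirat F hF hsq).obj Y.out), key, hβ,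
    isIsometry_toElemZero _, isPreStep_toBirat_map hι.2⟩

/-- **Def. 1.3 (v)(b) for `C^birat`, uniqueness**: the co-angular pre-steps `β, β′` are isomorphisms;
`γ := β⁻¹ ≫ β′`. [cite: MochizukiFrdI2008, Prop. 4.4 (ii) p.83] -/
theorem v_b_unique' ⦃X Y Z Z' : Birat F hF hsq⦄ (φ : X ⟶ Y) (β : X ⟶ Z) (α : Z ⟶ Y) (β' : X ⟶ Z')
    (α' : Z' ⟶ Y) (e : β ≫ α = φ) (hβ : IsCoAngularPreStep (toElemZero hF hsq) β)
    (_hα : IsIsometry (toElemZero hF hsq) α ∧ IsPreStep (toElemZero hF hsq) α) (e' : β' ≫ α' = φ)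
    (hβ' : IsCoAngularPreStep (toElemZero hF hsq) β')
    (_hα' : IsIsometry (toElemZero hF hsq) α' ∧ IsPreStep (toElemZero hF hsq) α') :
    ∃ γ : Z ≅ Z', β ≫ γ.hom = β' ∧ α = γ.hom ≫ α' := by
  haveI : IsIso β := isIso_of_isCoAngularPreStep' β hβ
  haveI : IsIso β' := isIso_of_isCoAngularPreStep' β' hβ'
  refine ⟨(asIso β).symm ≪≫ asIso β', ?_, ?_⟩
  · show β ≫ inv β ≫ β' = β'
    rw [IsIso.hom_inv_id_assoc]
  · show α = (inv β ≫ β') ≫ α'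
    rw [Category.assoc, e', ← e, IsIso.inv_hom_id_assoc]

/-- **Def. 1.3 (v)(c) for `C^birat`, existence**: `ψ = ψ ≫ id` (every pre-step of `C^birat` is an isometric
pre-step; the identity is a co-angular pre-step). [cite: MochizukiFrdI2008, Prop. 4.4 (ii) p.83] -/
theorem v_c_exists' ⦃X Y : Birat F hF hsq⦄ (ψ : X ⟶ Y) (hψ : IsPreStep (toElemZero hF hsq) ψ) :
    ∃ (Z : Birat F hF hsq) (β' : X ⟶ Z) (α' : Z ⟶ Y), β' ≫ α' = ψ ∧
      (IsIsometry (toElemZero hF hsq) β' ∧ IsPreStep (toElemZero hF hsq) β') ∧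
      IsCoAngularPreStep (toElemZero hF hsq) α' :=
  ⟨Y, ψ, 𝟙 Y, Category.comp_id ψ, ⟨isIsometry_toElemZero _, hψ⟩,
    (isCoAngularPreStep_iff_isIso' hF hsq _).mpr inferInstance⟩

/-- **Def. 1.3 (v)(c) for `C^birat`, uniqueness**: the co-angular pre-steps `α, α′` are isomorphisms;
`γ := α ≫ α′⁻¹`. [cite: MochizukiFrdI2008, Prop. 4.4 (ii) p.83] -/
theorem v_c_unique' ⦃X Y Z Z' : Birat F hF hsq⦄ (φ : X ⟶ Y) (β : X ⟶ Z) (α : Z ⟶ Y) (β' : X ⟶ Z')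
    (α' : Z' ⟶ Y) (e : β ≫ α = φ)
    (_hβ : IsIsometry (toElemZero hF hsq) β ∧ IsPreStep (toElemZero hF hsq) β)
    (hα : IsCoAngularPreStep (toElemZero hF hsq) α) (e' : β' ≫ α' = φ)
    (_hβ' : IsIsometry (toElemZero hF hsq) β' ∧ IsPreStep (toElemZero hF hsq) β')
    (hα' : IsCoAngularPreStep (toElemZero hF hsq) α') :
    ∃ γ : Z ≅ Z', β ≫ γ.hom = β' ∧ α = γ.hom ≫ α' := by
  haveI : IsIso α := isIso_of_isCoAngularPreStep' α hα
  haveI : IsIso α' := isIso_of_isCoAngularPreStep' α' hα'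
  refine ⟨asIso α ≪≫ (asIso α').symm, ?_, ?_⟩
  · show β ≫ α ≫ inv α' = β'
    rw [← Category.assoc, e, ← e', Category.assoc, IsIso.hom_inv_id, Category.comp_id]
  · show α = (α ≫ inv α') ≫ α'
    rw [Category.assoc, IsIso.inv_hom_id, Category.comp_id]

/-- **Def. 1.3 (vi) for `C^birat`**, every Frobenioid `C`: base-equivalent co-angular pre-steps
(isomorphisms) `φ, ψ` differ by the unit `ψ⁻¹ ≫ φ`. [cite: MochizukiFrdI2008, Prop. 4.4 (ii) p.83] -/
theorem vi' ⦃X Y : Birat F hF hsq⦄ (φ ψ : X ⟶ Y) (hφ : IsCoAngularPreStep (toElemZero hF hsq) φ)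
    (hψ : IsCoAngularPreStep (toElemZero hF hsq) ψ) (hb : BaseEquivalent (toElemZero hF hsq) φ ψ)
    (_hm : MetricallyEquivalent (toElemZero hF hsq) φ ψ) :
    ∃ α ∈ unitsSubgroup (toElemZero hF hsq) Y, ψ ≫ α.hom = φ := by
  haveI : IsIso φ := isIso_of_isCoAngularPreStep' φ hφ
  haveI : IsIso ψ := isIso_of_isCoAngularPreStep' ψ hψ
  have hb' : Base (toElemZero hF hsq) φ = Base (toElemZero hF hsq) ψ := hb
  have ha : ψ ≫ (inv ψ ≫ φ) = φ := by rw [IsIso.hom_inv_id_assoc]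
  have hab : IsBaseIdentity (toElemZero hF hsq) (inv ψ ≫ φ) := by
    haveI := (isPreFrobenioid hF hsq).isTotallyEpimorphic_base.epi (Base (toElemZero hF hsq) ψ)
    apply (cancel_epi (Base (toElemZero hF hsq) ψ)).mp
    rw [← base_comp, ha, Category.comp_id, hb']
  exact ⟨asIso (inv ψ ≫ φ), ⟨hab, isLinear_of_isIso (toElemZero hF hsq) _⟩, ha⟩

/-! ### Def. 1.3 (vii) -/

/-- **Def. 1.3 (vii)(a) for `C^birat`**, every Frobenioid `C`: the image `h^birat` of an isotropic hull
`h : A → A^istr` of `C` is an isotropic hull of `A^birat`. It is an isometric pre-step into an isotropic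
object; a morphism `[(δ, γ′)] : A^birat ⇢ Z` with `Z` isotropic factors uniquely through it: with `h_E`
the isotropic hull of the apex `E` of the fraction, `δ ≫ h = h_E ≫ d′` and `γ′ = h_E ≫ g′`, where the
induced `d′ : E^istr → A^istr` is a pre-step out of an isotropic object, hence co-angular (Def. 1.3
(vii)(b)), hence invertible in `C^birat`; then `β := (d′^birat)⁻¹ ≫ g′^birat`. Uniqueness: `h^birat` is an
epimorphism. [cite: MochizukiFrdI2008, Prop. 4.4 (ii) p.83] -/
theorem vii_a' (X : Birat F hF hsq) :
    ∃ (Y : Birat F hF hsq) (φ : X ⟶ Y), IsIsotropicHull (toElemZero hF hsq) φ := by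
  obtain ⟨H, h, _, hhpre, hH, huniv⟩ := hF.vii_a X.out
  refine ⟨(toBirat F hF hsq).obj H, ((toBirat F hF hsq).map h : (toBirat F hF hsq).obj X.out ⟶ _),
    isIsometry_toElemZero _, isPreStep_toBirat_map hhpre, (isIsotropic_toBirat_obj_iff H).mpr hH, ?_⟩
  intro Z γ hZ
  have hZ' : IsIsotropic F Z.out := (isIsotropic_iff_out Z).mp hZ
  refine existsUnique_of_exists_of_unique ?_
    (fun β₁ β₂ h₁ h₂ => ((isTotallyEpimorphic hF hsq).epi _).left_cancellation β₁ β₂ (h₁.trans h₂.symm))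
  obtain ⟨g, rfl⟩ := homMk_surjective γ
  -- the fraction `(δ, γ′) = (g.den, g.num)` with apex `E = g.src`; the hull of `E`
  obtain ⟨HE, hE, _, hEpre, hHE, hunivE⟩ := hF.vii_a g.src
  obtain ⟨d', hd', -⟩ := hunivE (g.den ≫ h) hH
  obtain ⟨g', hg', -⟩ := hunivE g.num hZ'
  -- `d′` is a co-angular pre-step
  have hd'pre : IsPreStep F d' := by
    refine ⟨?_, ?_⟩
    · have e := congrArg (degFr F) hd'
      rw [degFr_comp, degFr_comp, hEpre.1, one_mul, g.den_mem.2.1, hhpre.1, one_mul] at e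
      exact e
    · haveI : IsIso (Base F hE) := hEpre.2
      haveI : IsIso (Base F g.den) := g.den_mem.2.2
      haveI : IsIso (Base F h) := hhpre.2
      haveI : IsIso (Base F hE ≫ Base F d') := by
        rw [← base_comp, hd', base_comp]; infer_instance
      exact IsIso.of_isIso_comp_left (Base F hE) (Base F d')
  have hd'co : IsCoAngularPreStep F d' :=
    ⟨isCoAngular_of_isIsotropic_codomains F d' fun _ ψ => hF.vii_b ψ hHE, hd'pre⟩
  haveI := toBirat_inverts hF hsq d' hd'co
  haveI := toBirat_inverts hF hsq g.den g.den_mem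
  refine ⟨inv ((toBirat F hF hsq).map d') ≫ (toBirat F hF hsq).map g', ?_⟩
  -- the equation, after composing with the epimorphism `δ^birat`
  have key : (toBirat F hF hsq).map h ≫ inv ((toBirat F hF hsq).map d') ≫ (toBirat F hF hsq).map g' =
      (homMk g : (toBirat F hF hsq).obj X.out ⟶ (toBirat F hF hsq).obj Z.out) := by
    rw [← cancel_epi ((toBirat F hF hsq).map g.den), toBirat_map_den_comp_homMk hF hsq g,
      ← (toBirat F hF hsq).map_comp_assoc g.den h, ← hd', Functor.map_comp, Category.assoc,
      IsIso.hom_inv_id_assoc, ← Functor.map_comp, hg']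
  exact key

/-- **Def. 1.3 (vii)(b) for `C^birat`**, every Frobenioid `C`: along `[(δ, φ′)] : X ⇢ Y` with `X^birat`
isotropic, `X` is isotropic, hence the apex of the fraction (a co-angular pre-step into `X`), hence `Y`
(Def. 1.3 (vii)(b) of `C`), hence `Y^birat`. [cite: MochizukiFrdI2008, Prop. 4.4 (ii) p.83] -/
theorem vii_b' ⦃X Y : Birat F hF hsq⦄ (φ : X ⟶ Y) (hX : IsIsotropic (toElemZero hF hsq) X) :
    IsIsotropic (toElemZero hF hsq) Y := by
  obtain ⟨f, rfl⟩ := homMk_surjective φ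
  have hX' : IsIsotropic F X.out := (isIsotropic_iff_out X).mp hX
  have hsrc : IsIsotropic F f.src := isIsotropic_of_isCoAngularPreStep hF f.den_mem hX'
  exact (isIsotropic_iff_out Y).mpr (hF.vii_b f.num hsrc)

/-! ### The theorem -/

variable (hF hsq) in
/-- **[FrdI] Proposition 4.4 (ii) in the author's corrected 2024 form ((29)(i)), GENERAL CASE: for EVERY
Frobenioid `C` all of whose objects are birationally Frobenius-normalized (Def. 4.5 (i)), the
pre-Frobenioid `C^birat → F_{0_D}` IS A FROBENIOID** — no isotropy hypothesis. The normalization is used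
only for Def. 1.3 (iii)(c) (commutativity of `O^▷(X^birat)`). [cite: MochizukiFrdI2008, Prop. 4.4 (ii) p.83] -/
theorem isFrobenioid_general (hbfn : ∀ A : C, IsBiratFrobeniusNormalized F hF hsq A) :
    IsFrobenioid (toElemZero hF hsq) where
  isPreFrobenioid := isPreFrobenioid hF hsq
  i_a := i_a'
  i_b := i_b
  i_c := i_c
  ii_exists := ii_exists'
  ii_unique := ii_unique'
  iii_a := iii_a'
  iii_b := iii_b'
  iii_c := iii_c'
  iii_c_base := iii_c_base' hbfn
  iii_d_under_full := iii_d_under_full'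
  iii_d_under_surj := iii_d_under_surj'
  iii_d_over_full := iii_d_over_full'
  iii_d_over_surj := iii_d_over_surj'
  iv_a_exists := iv_a_exists'
  iv_a_unique := iv_a_unique'
  iv_b := iv_b'
  v_a := v_a'
  v_b_exists := v_b_exists'
  v_b_unique := v_b_unique'
  v_c_exists := v_c_exists'
  v_c_unique := v_c_unique'
  vi := vi'
  vii_a := vii_a'
  vii_b := vii_b'

/-- The same with the square-completion hypothesis `hsq` discharged (Prop. 1.11 (vii), abc-iut-L6-t6's
`hasBiratSquares_of_isFrobenioid`): every Frobenioid all of whose objects are birationally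
Frobenius-normalized has a Frobenioid as its birationalization. [cite: MochizukiFrdI2008, Prop. 4.4 (ii) p.83] -/
theorem isFrobenioid_general_of_isFrobenioid (hF : IsFrobenioid F)
    (hbfn : ∀ A : C, IsBiratFrobeniusNormalized F hF (hasBiratSquares_of_isFrobenioid hF) A) :
    IsFrobenioid (toElemZero hF (hasBiratSquares_of_isFrobenioid hF)) :=
  isFrobenioid_general hF _ hbfn

end Birat

/-- **[FrdI] Prop. 4.4 (ii) (2024 form), general case, in the §3–§5 interface shape**: the functor of THE
birationalization's operations `(biratOps hF hsq).toFunctor` — definitionally `Birat.toElemZero hF hsq` —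
is a Frobenioid for every Frobenioid all of whose objects are birationally Frobenius-normalized (the shape
of the hypothesis `hBi` of the cell's Prop. 5.5 sub-DAG slots, now WITHOUT isotropy).
[cite: MochizukiFrdI2008, Prop. 4.4 (ii) p.83] -/
theorem isFrobenioid_biratOps_toFunctor_general (hF : IsFrobenioid F) (hsq : HasBiratSquares F)
    (hbfn : ∀ A : C, IsBiratFrobeniusNormalized F hF hsq A) :
    IsFrobenioid (biratOps hF hsq).toFunctor :=
  Birat.isFrobenioid_general hF hsq hbfn

namespace Birat

/-- **[FrdI] Prop. 4.4 (ii) (2024 form) for Frobenioids of MODEL type** (Def. 4.5 (i): pre-model and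
birationally Frobenius-normalized type, abc-iut-L6-t8's `IsOfModelType`): their birationalization
`C^birat → F_{0_D}` is a Frobenioid — now WITHOUT the isotropy hypothesis of
`Birat.isFrobenioid_of_isOfModelType`. [cite: MochizukiFrdI2008, Prop. 4.4 (ii) p.83] -/
theorem isFrobenioid_of_isOfModelType' (hF : IsFrobenioid F) (hsq : HasBiratSquares F)
    (hmod : IsOfModelType F hF hsq) : IsFrobenioid (toElemZero hF hsq) :=
  isFrobenioid_general hF hsq hmod.2

end Birat

end PreFrobenioid

end Literature.AlgebraicGeometry.Frobenioids
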